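import Summits.Parity.GeneralizedHardyLittlewood.Theses.LiouvilleMAD
import Summits.Parity.GeneralizedHardyLittlewood.Theorems.LiouvilleMADTypeIIToLevel
import Summits.Parity.GeneralizedHardyLittlewood.Theorems.LambdaLiouvilleLevel.Negative.LambdaLiouvilleLevelHLCFace
import HarnessLib

/-!
# Crux `LambdaLiouvilleLevel` (stmt-Parity-13325, route `LiouvilleMAD`) — line `log-power-dispersion`

Planner skeleton (crux-plan, 2026-08-16; idea card `Cruxes/LambdaLiouvilleLevel/Ideas/log-power-dispersion.md`,
triage `TRIAGE-r1-1.md` / `TRIAGE-r1-2.md`: pass ×2; line card `Lines/log-power-dispersion.md`; this file is published as `Lines/log_power_dispersion.lean`).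

THE CRUX (verbatim `Summit.Parity.GeneralizedHardyLittlewood.Theses.LiouvilleMAD.LambdaLiouvilleLevel`):
Bombieri–Vinogradov at level `N^{ε₀}` for `Λ(n)λ(n+h)` —
`∀ h ≠ 0, ∃ ε₀ > 0, ∀ A > 0, ∃ C N₀, ∀ N ≥ N₀, ∀ w y : ℕ → ℕ, (∀ q, y q ≤ N) →
  Σ_{q ≤ ⌊N^{ε₀}⌋} |Σ_{n ≤ y q, n ≡ w q (q)} Λ(n) λ(n+h)| ≤ C N/(log N)^A`.

THE LINE (keep the classes, row-sum the dilations).  Inside the route's own Vaughan frame for this node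
(`U = V = ⌊N^{1/10}⌋`; tree engine `Theorems/LiouvilleMADTypeIIToLevel*.lean`, whose type-I half —
`TypeIIToLevel.typeI_budget`, Bombieri–Vinogradov for `λ` = the PROVED `LiouvilleShiftedTables.BVLiouville` — is
reused verbatim), the type-II piece `Σ_{d>U} Λ(d) Σ_{m>U} G_U(m) λ(dm+h) 1[dm ≡ w (q)]` is bounded CLASS BY CLASS:
Cauchy–Schwarz over the longer variable INSIDE each class pair `(u, v)`, `uv ≡ w (q)`, closed by Schur's test on
the Gram matrix of Liouville pairs (`ClassSchurInequality`).  The per-modulus bound then scales like `1/q` in the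
diagonal and like `RS(q)^{1/2}` off the diagonal, so the `ℓ¹` over `q ≤ N^{ε}` costs `Σ 1/q ≈ log N` — not the
`N^{3ε/2}` of the class-blind full-box bound — and the only parity-sensitive input left is ONE log-power, prime-free,
coefficient-free statement: `RowSumAffineChowla` (RSA), `ℓ¹`-in-`q` (weight `q`) row sums of the class Gram matrices
`G_v(m₀, m′) = Σ_{k ∼ K, k ≡ v (q)} λ(m₀k+h)λ(m′k+h)` at `(log y)^{−A}`.  No power of `N` is saved by `λ` anywhere
(the type-II diagonal is killed by Vaughan's `U = N^{1/10}`); coefficients are carried in `ℓ²` (`|G_U| ≤ τ` has sup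
`N^{o(1)}`, TRIAGE-r1-1 sharpen (2)), the cut `dm ≤ y_q` is removed by `(log N)^{A+4}` short intervals of `d` per
dyadic block with the boundary strips counted by the hyperbola method in one coprime class (no Perron, no Shiu).

CHAIN (each arrow one stub; the composition `LambdaLiouvilleLevel_of` is proved, pure logic):
`RowSumAffineChowla h` (stub_rowSumAffineChowla — OPEN, conjecture-grade, the hardest stub)
  —[stub_classTypeII, with stub_classSchur]→ `ClassTypeIILog h` (log-power type II for `λ(mk+h)` in one coprime
  class per modulus, `ℓ¹` over `q ≤ y^{ε₂}`, arbitrary `q`-dependent `ℓ²` coefficients)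
  —[stub_typeIIPiece, with stub_classDivisorShortSum and stub_typeIIPieceDecomp]→ `TypeIIPieceLog h` (the
  `F_U * G_U` piece of Vaughan, summed over `q ≤ N^{ε₃}`, heights `y_q ≤ N`)
  —[stub_vaughanAssembly]→ `LevelAt h` (= the crux at the shift `h`; `LambdaLiouvilleLevel ↔ ∀ h ≠ 0, LevelAt h` is `Iff.rfl`).

RESHAPE BY THE LEAD (prover-line-stmt-Parity-13325-a1-0, cycle 1, 2026-08-16): the planner's L-sized `stub_typeIIPiece`
(`ClassTypeIILog h → TypeIIPieceLog h`, "the new ℓ² engine", 600–900 lines) is cut at the skeleton level into three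
registered stubs with the same composition idea — (i) `stub_typeIIPieceDecomp : TypeIIPieceDecomp` (exact per-modulus
combinatorics: dyadic blocks of `d`, `K_s` short intervals per block, dyadic boxes of `m`, and ALL boundary pairs
`(d, m)` mapped to `n = dm ∈ (x − N/K_s − 1, x]` with `Σ_{dm = n} Λ(d) τ(m) ≤ τ(n) log n`), (ii)
`stub_classDivisorShortSum : ClassDivisorShortSum` (hyperbola method in ONE coprime class:
`Σ_{Z₁ < n ≤ Z₂, n ≡ w (q)} τ(n) ≤ 2((Z₂−Z₁)/q + 1)(1 + log Z₂) + 2√Z₂`), (iii) `stub_typeIIPiece (h) :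
ClassDivisorShortSum → TypeIIPieceDecomp → ClassTypeIILog h → TypeIIPieceLog h` (the `ℓ²` bookkeeping: `Σ Λ² ≤
(D/K_s + 1) log² 2D` on a short interval, `Σ τ² ≪ M log⁸ M` (`Sieve.exists_sum_sigma_zero_pow_le_real 2`), sums over
boxes and moduli). Seven stubs in all (= stubs_max); `LambdaLiouvilleLevel_of` re-checked.

CALIBRATION (tree, kernel-checked): `TypeIIToLevel_proof : TypeIILiouville → LambdaLiouvilleLevel` (stmt-Parity-14996) and
`Negative.hlc_one_one_of_lambdaLiouvilleLevel` (crux ⟹ hybrid HLC(1,1), p96019): the crux sits between the open crux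
`TypeIILiouville` and open HLC(1,1); this line replaces the POWER-saving, arbitrary-coefficient `TypeIILiouville` by the
LOG-power row-sum statement RSA (instance-wise weaker: `TypeIILiouville ⟹ RSA` with sign coefficients, TRIAGE-r1-2).

DISPROOF USED (`Cruxes/LambdaLiouvilleLevel/Disproof.lean`, cdisprove cycle 1, read 2026-08-16T11:05Z):
`lambdaLiouvilleLevel_false_without_hne` (any proof must use `h ≠ 0`) — used at `stub_rowSumAffineChowla` (at `h = 0`
every Gram entry is `λ(m₀)λ(m′)·#T_v`, RSA is false; the three reduction stubs do not need it);
`lambdaLiouvilleLevel_false_without_heightCap` (any proof must use `∀ q, y q ≤ N`) — used at `stub_typeIIPiece`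
(boxes `(D,2D] × (M,2M]` are invoked only with `D·M ≤ N`, `ClassTypeIILog` at `y = N`) and at `stub_vaughanAssembly`
(type-I heights `dt + h ≤ 2N`); `not_lambdaLiouvilleLevelLogPowerLevel` / `not_lambdaLiouvilleLevelOne` (level
`N/(log N)^B` is false via non-coprime residues `w_q = 0`, `y_q = q`) — respected: the line keeps a power level
`N^{ε₀}`, `ε₀ ≤ ε₃ ≤ ε₂ ≤ ε₁ < 1/10`, and reduces to coprime residues FIRST (`stub_vaughanAssembly`: for `Λ`-supported
`n ≡ w (q)` with `(w,q) > 1`, `n` is a power of a prime dividing `q`, total `≤ N^{ε₀} log² N`), exactly the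
disproof's MORAL. `-- Targets` of the disproof: empty (no line existed). Negatives index (stmt-Parity-4218 free window,
9541, 14832): no stub is an instance — RSA / ClassTypeIILog / TypeIIPieceLog begin with `∃ ε` and pin both blocks
`≥ ⌊y^{1/10}⌋`, so no degenerate window is admissible.
-/

noncomputable section

namespace Summit.Parity.GeneralizedHardyLittlewood.Cruxes.LambdaLiouvilleLevel.LogPowerDispersion

open Finset Real
open Summit.Parity.GeneralizedHardyLittlewood.Theses.LiouvilleMAD (LambdaLiouvilleLevel TypeIILiouville)
open Literature.NumberTheory.Sieve.Vaughan (fU gU)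

/-! ## The statements of the line -/

/-- **RSA — `ℓ¹`-in-`q` row-sum affine dilated Chowla at log-power** (the line's ONE parity-sensitive input;
conjecture-grade).  For the shift `h` there is `ε₁ > 0` such that for every `A`, all large `y`, all blocks
`⌊y^{1/10}⌋ ≤ M ≤ K`, `MK ≤ y`, and every choice, per modulus `q`, of a row class `u q`, a column class `v q` and a
row `m₀ q ∈ (M,2M]` in the class `u q`:
`Σ_{q ≤ y^{ε₁}} q · Σ_{m′ ∈ (M,2M], m′ ≡ u q (q), m′ ≠ m₀ q} |Σ_{k ∈ (K,2K], k ≡ v q (q)} λ(m₀ q·k + h) λ(m′k + h)|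
≤ C·M·K/(log y)^A`
(trivial size `≍ MK log y`; random size `≍ M K^{1/2} y^{ε₁/2}`).  Each Gram entry is a two-point Liouville sum along
the non-parallel affine pair `(m₀q·t + m₀v + h, m′q·t + m′v + h)` (`h(m₀ − m′) ≠ 0`); at `q = 1` RSA is implied by the
route's `DilatedChowla` (sum the row) and for all `q` by `TypeIILiouville` (sign coefficients, TRIAGE-r1-2); it asks
NO power saving, is never pointwise, and is Siegel-robust by the `ℓ¹` weight `q` (card, "Disproof used").  FALSE at
`h = 0` (entries `λ(m₀)λ(m′)·#T`), whence the guard in `stub_rowSumAffineChowla`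
(Disproof `lambdaLiouvilleLevel_false_without_hne`).
[cite: card:log-power-dispersion; MatomakiRadziwillTao2015; TaoFMP2016; arXiv:1809.02518; doi:10.1112/plms.12546;
kit j015473, j016353, j016355 (square-root law for 848 RSA rows, no class bias)] -/
def RowSumAffineChowla (h : ℤ) : Prop :=
  ∃ ε₁ : ℝ, 0 < ε₁ ∧ ∀ A : ℝ, 0 < A → ∃ C : ℝ, ∃ y₀ : ℕ, ∀ y : ℕ, y₀ ≤ y →
    ∀ M K : ℕ, ⌊(y : ℝ) ^ (1 / 10 : ℝ)⌋₊ ≤ M → M ≤ K → M * K ≤ y →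
    ∀ u v m₀ : ℕ → ℕ, (∀ q, 1 ≤ q → m₀ q ∈ Finset.Ioc M (2 * M) ∧ m₀ q ≡ u q [MOD q]) →
      (∑ q ∈ Finset.Icc 1 ⌊(y : ℝ) ^ ε₁⌋₊, (q : ℝ) *
        ∑ m' ∈ (Finset.Ioc M (2 * M)).filter (fun m' : ℕ => m' ≡ u q [MOD q] ∧ m' ≠ m₀ q),
          |∑ k ∈ (Finset.Ioc K (2 * K)).filter (fun k : ℕ => k ≡ v q [MOD q]),
            (ArithmeticFunction.liouville (Int.toNat (((m₀ q * k : ℕ) : ℤ) + h)) : ℝ) *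
              (ArithmeticFunction.liouville (Int.toNat (((m' * k : ℕ) : ℤ) + h)) : ℝ)|) ≤
        C * M * K / Real.log y ^ A

/-- **Class-aware Schur test** (Cauchy–Schwarz over `k ∈ T`, then `⟨α, |G| α⟩ ≤ ‖α‖² · max row sum of |G|` by the
symmetry of `|G(m,m′)| = |Σ_{k∈T} f(m,k) f(m′,k)|` and `2|α_m α_{m′}| ≤ α_m² + α_{m′}²`): the bound sees the sizes
of the class box `S × T`, not of the ambient box.  Provable now (M). [cite: card:log-power-dispersion (First lemma);
IwaniecKowalski2004 (Schur / duality, §7.1)] -/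
def ClassSchurInequality : Prop :=
  ∀ (S T : Finset ℕ) (α β : ℕ → ℝ) (f : ℕ → ℕ → ℝ) (R : ℝ),
    (∀ m ∈ S, ∑ m' ∈ S, |∑ k ∈ T, f m k * f m' k| ≤ R) →
      (∑ m ∈ S, ∑ k ∈ T, α m * β k * f m k) ^ 2 ≤ (∑ k ∈ T, β k ^ 2) * (∑ m ∈ S, α m ^ 2) * R

/-- **Log-power class type II** (the node between RSA and the Vaughan frame).  For the shift `h` there is `ε₂ > 0`
such that for every `A`, all large `y`, all blocks `M, K ≥ ⌊y^{1/10}⌋` with `MK ≤ y`, all `q`-DEPENDENT coefficient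
families `α q`, `β q` with `Σ_{m∼M} (α q m)² ≤ P`, `Σ_{k∼K} (β q k)² ≤ R` for every `q`, and one COPRIME residue
`w q` per modulus:
`Σ_{q ≤ y^{ε₂}} |Σ_{m ∈ (M,2M]} Σ_{k ∈ (K,2K]} 1[mk ≡ w q (q)] α q m · β q k · λ(mk + h)| ≤ C √P √R √(MK)/(log y)^A`.
From RSA + Schur (stub_classTypeII): per `q` the pairs split by the unit class `v` of `k` (`m ≡ w v⁻¹`), Schur in
each class pair gives `‖α_{S_v}‖‖β_{T_v}‖ (K/q + 1 + RS_v(q))^{1/2}`, the classes are disjoint so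
`Σ_v ‖α_{S_v}‖‖β_{T_v}‖ ≤ √P√R`, the diagonal sums to `2√(KQ) + Q ≤ √(MK)(log y)^{−A}` because BOTH blocks are
`≥ ⌊y^{1/10}⌋ ≫ y^{ε₂}(log y)^{2A}`, and `Σ_q RS(q)^{1/2} ≤ (Σ_q q·RS(q))^{1/2}(Σ_q 1/q)^{1/2}` is RSA with
`A′ = 2A + 2` (symmetric in `(M, α) ↔ (K, β)`: take rows = the shorter block).  Coprimality makes `v ↦ w v⁻¹` a
bijection on units (non-coprime classes are disposed of BEFORE Vaughan, in stub_vaughanAssembly).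
[cite: card:log-power-dispersion (Transfer); Harman2007 §14.2; Polymath8b2014 §8] -/
def ClassTypeIILog (h : ℤ) : Prop :=
  ∃ ε₂ : ℝ, 0 < ε₂ ∧ ∀ A : ℝ, 0 < A → ∃ C : ℝ, ∃ y₀ : ℕ, ∀ y : ℕ, y₀ ≤ y →
    ∀ M K : ℕ, ⌊(y : ℝ) ^ (1 / 10 : ℝ)⌋₊ ≤ M → ⌊(y : ℝ) ^ (1 / 10 : ℝ)⌋₊ ≤ K → M * K ≤ y →
    ∀ (α β : ℕ → ℕ → ℝ) (P R : ℝ),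
      (∀ q, ∑ m ∈ Finset.Ioc M (2 * M), α q m ^ 2 ≤ P) →
      (∀ q, ∑ k ∈ Finset.Ioc K (2 * K), β q k ^ 2 ≤ R) →
    ∀ w : ℕ → ℕ, (∀ q, 1 ≤ q → Nat.Coprime (w q) q) →
      (∑ q ∈ Finset.Icc 1 ⌊(y : ℝ) ^ ε₂⌋₊,
        |∑ m ∈ Finset.Ioc M (2 * M), ∑ k ∈ Finset.Ioc K (2 * K),
          (if m * k ≡ w q [MOD q] then
            α q m * β q k * (ArithmeticFunction.liouville (Int.toNat (((m * k : ℕ) : ℤ) + h)) : ℝ)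
           else 0)|) ≤
        C * Real.sqrt P * Real.sqrt R * Real.sqrt ((M : ℝ) * K) / Real.log y ^ A

/-- **The type-II piece of Vaughan's identity at log-power, summed over the moduli** (`U = ⌊N^{1/10}⌋`, tree objects
`Vaughan.fU U = Λ·1_{>U}`, `Vaughan.gU U = (μ − μ_{≤U}) * ζ`, `|gU| ≤ τ`, `gU = 0` on `[1,U]`): for the shift `h`
there is `ε₃ > 0` such that for every `A`, all large `N`, all heights `y q ≤ N` and coprime residues `w q`,
`Σ_{q ≤ N^{ε₃}} |Σ_{n ≤ y q} (F_U * G_U)(n) · 1[n ≡ w q (q)] λ(n+h)| ≤ C N/(log N)^A`.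
From `ClassTypeIILog` (stub_typeIIPiece, the new `ℓ²` engine): `Σ_n = Σ_{d>U} Λ(d) Σ_{U<m≤y_q/d} gU(m)·lam_q(dm)`
(`Sieve.sum_Ioc_mul_apply_mul_eq_sum_sum`); dyadic `d ∈ (D,2D]`, `D = U2^i < N/U`; each block cut into
`K_s = ⌈(log N)^{A+4}⌉` short intervals `(E_a, E_{a+1}]` (tree pattern `abs_block_le`); on `(E_a,E_{a+1}]` replace
`m ≤ y_q/d` by `m ≤ X_a(q) := ⌊y_q/E_{a+1}⌋` — the rectangles are `ClassTypeIILog` boxes `(D,2D] × (M_j,2M_j]`,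
`M_j = U2^j`, `D·M_j ≤ N`, at `y = N` with `α q d = Λ(d)1_{(E_a,E_{a+1}]}(d)` (`P ≤ (D/K_s + 1) log² N`) and the
`q`-dependent `β q m = gU(m) 1[U < m ≤ X_a(q)]` (`R ≤ Σ_{m∼M_j} τ(m)² ≪ M_j log³ N`,
`Sieve.exists_sum_sigma_zero_pow_le_real 2`), total `≪ N K_s^{1/2} (log N)^{9/2 − A′}` over the `≤ K_s log² N`
boxes; the boundary pairs `X_a(q) < m ≤ y_q/d` have `dm ∈ (y_q − Δ, y_q]`, `Δ ≤ N/K_s + 3N/U + 2`, and contribute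
`≤ log N · Σ_{y_q−Δ < n ≤ y_q, n ≡ w_q (q)} τ(n) ≤ log N · (2(Δ/q)(1 + log N) + 2√N)` by the hyperbola method in ONE
coprime class (`a ∣ n`, `n ≡ w (q)`, `(w,q) = 1` ⟹ `(a,q) = 1`, one class mod `aq`), i.e. `≪ N(log N)^{−A−1}` after
`Σ_q 1/q`.  Uses the height cap `y q ≤ N` (Disproof `…_false_without_heightCap`). Provable now (L).
[cite: Vaughan1980; IwaniecKowalski2004 §13.4; FriedlanderIwaniecAnnals1998 §26; card:log-power-dispersion] -/
def TypeIIPieceLog (h : ℤ) : Prop :=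
  ∃ ε₃ : ℝ, 0 < ε₃ ∧ ∀ A : ℝ, 0 < A → ∃ C : ℝ, ∃ N₀ : ℕ, ∀ N : ℕ, N₀ ≤ N →
    ∀ w y : ℕ → ℕ, (∀ q, y q ≤ N) → (∀ q, 1 ≤ q → Nat.Coprime (w q) q) →
      (∑ q ∈ Finset.Icc 1 ⌊(N : ℝ) ^ ε₃⌋₊,
        |∑ n ∈ Finset.Ioc 0 (y q),
          (fU ⌊(N : ℝ) ^ (1 / 10 : ℝ)⌋₊ * gU ⌊(N : ℝ) ^ (1 / 10 : ℝ)⌋₊) n *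
            (if n ≡ w q [MOD q] then (ArithmeticFunction.liouville (Int.toNat ((n : ℤ) + h)) : ℝ) else 0)|) ≤
        C * N / Real.log N ^ A

/-- **Divisor sums on a short interval in ONE coprime class (hyperbola method).**  For `q ≥ 1`, `(w, q) = 1`
and `Z₁ ≤ Z₂`: `Σ_{Z₁ < n ≤ Z₂, n ≡ w (q)} τ(n) ≤ 2((Z₂ − Z₁)/q + 1)(1 + log Z₂) + 2√Z₂`.  Proof: `τ(n) ≤
2·#{a ∣ n : a ≤ √n} ≤ 2·#{a ∣ n : a ≤ √Z₂}`; swap: for each `a ≤ √Z₂`, the `n = ab` counted have `(a, q) = 1`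
(a common prime of `a` and `q` would divide `n ≡ w`, contradicting `(w, q) = 1`), so `b` runs over ONE class
`b ≡ w a⁻¹ (q)` inside the real interval `(Z₁/a, Z₂/a]`, at most `(Z₂ − Z₁)/(aq) + 1` values; sum `a ≤ √Z₂` with
`Σ_{a ≤ t} 1/a ≤ 1 + log t` and `log √Z₂ ≤ log Z₂`.  Elementary; provable now (M).  (Lead's reshape, cycle 1: the
boundary-strip input of `stub_typeIIPiece`.) [folklore; cite: IwaniecKowalski2004 §1.5 (hyperbola method)] -/
def ClassDivisorShortSum : Prop :=
  ∀ q w Z₁ Z₂ : ℕ, 1 ≤ q → Nat.Coprime w q → Z₁ ≤ Z₂ →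
    (∑ n ∈ (Finset.Ioc Z₁ Z₂).filter (fun n : ℕ => n ≡ w [MOD q]), ((Nat.divisors n).card : ℝ)) ≤
      2 * ((((Z₂ - Z₁ : ℕ) : ℝ)) / q + 1) * (1 + Real.log Z₂) + 2 * Real.sqrt Z₂

/-- **The type-II piece of Vaughan's identity, decomposed (one modulus, exact combinatorics + trivial bounds).**
Parameters: `U ≥ 2` (Vaughan), `K_s ≥ 1` (short intervals per dyadic block), a height `x ≤ N ≤ U·2^J`, a modulus
`q ≥ 1`, a residue `w` (no coprimality needed here), a shift `h`.  With the class weight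
`lam(n) = 1[n ≡ w (q)] λ(n + h)`, the blocks `D_i = U 2^i` (`i < J`), the cut points
`E_{i,a} = D_i + ⌊a D_i / K_s⌋` (`a ≤ K_s`; `E_{i,0} = D_i`, `E_{i,K_s} = 2D_i`, `E_{i,a+1} − E_{i,a} ≤ D_i/K_s + 1`)
and the boxes `(D_i, 2D_i] × (M_j, 2M_j]`, `M_j = U 2^j`, restricted to `D_i M_j ≤ N`:
`|Σ_{n ≤ x} (F_U * G_U)(n) lam(n)| ≤ Σ_{i<J} Σ_{a<K_s} Σ_{j<J, D_i M_j ≤ N} |B_{i,a,j}| + log N · Σ_{x−N/K_s−1 < n ≤ x,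
n ≡ w (q)} τ(n)`, where `B_{i,a,j} = Σ_{d ∈ (D_i,2D_i]} Σ_{m ∈ (M_j,2M_j]} 1[dm ≡ w (q)] (Λ(d) 1[E_{i,a} < d ≤ E_{i,a+1}])
(G_U(m) 1[m ≤ x/E_{i,a+1}]) λ(dm + h)` is LITERALLY a `ClassTypeIILog` box summand (`α q d`, `β q m`, the latter
`q`-dependent through `x = y_q`).  Proof: `Σ_n (F_U*G_U)(n) lam(n) = Σ_{d ≤ x} F_U(d) Σ_{m ≤ x/d} G_U(m) lam(dm)`
(`Sieve.sum_Ioc_mul_apply_mul_eq_sum_sum`); extend `d` to `(0, U2^J]` (`x/d = 0` beyond `x`), drop `d ≤ U`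
(`F_U = 0`) and replace `F_U` by `Λ`; blocks (`Vaughan.sum_Ioc_mul_two_pow_eq_sum`), short intervals
(`FriedlanderIwaniecPrimes.PrimeSumEngine.sum_Ioc_eq_sum_range_pieces`, cut points as in `TypeIIToLevel.abs_block_le`);
for `d ∈ (E_{i,a}, E_{i,a+1}]` split `m ≤ x/d` at `X = ⌊x/E_{i,a+1}⌋ ≤ x/d`; MAIN part: extend `m` to `(0, U2^J]` with
the indicator `m ≤ X`, drop `m ≤ U` (`G_U = 0`, `Vaughan.gU_eq_zero_of_le`), dyadic `m`-blocks, and boxes with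
`D_i M_j > N` vanish (`m > M_j ≥ N/D_i ≥ x/E_{i,a+1} ≥ X`); BOUNDARY part: every pair has `dm ≤ x` and
`dm ≥ (E_{i,a}+1)(X+1) > x (E_{i,a}+1)/E_{i,a+1} ≥ x(1 − 1/K_s) ≥ x − N/K_s`, distinct pairs with equal `n = dm` have
distinct `d ∣ n`, `|G_U(m)| ≤ τ(m) ≤ τ(n)` (`Vaughan.abs_gU_le`, `Nat.divisors` monotone under `∣`), `|lam| ≤ 1[· ≡ w]`,
and `Σ_{d ∣ n} Λ(d) = log n ≤ log N` (`ArithmeticFunction.vonMangoldt_sum`) — conveniently via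
`Σ_{d ≤ x} Σ_{m ≤ x/d} F(d,m) = Σ_{n ≤ x} Σ_{dm = n} F(d,m)` (`Vaughan.sum_Ioc_sum_divisorsAntidiagonal_eq`) applied to
the nonnegative majorant `F(d,m) = Λ(d) τ(m) 1[dm ≡ w] 1[x − N/K_s − 1 < dm]`.  Provable now (M/L).  (Lead's reshape,
cycle 1: the combinatorial half of the planner's `stub_typeIIPiece`.) [folklore; Vaughan1980; FriedlanderIwaniecAnnals1998 §26;
IwaniecKowalski2004 §13.4] -/
def TypeIIPieceDecomp : Prop :=
  ∀ (h : ℤ) (U Ks J N x q w : ℕ), 2 ≤ U → 0 < Ks → x ≤ N → N ≤ U * 2 ^ J → 1 ≤ q →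
    |∑ n ∈ Finset.Ioc 0 x, (fU U * gU U) n *
        (if n ≡ w [MOD q] then (ArithmeticFunction.liouville (Int.toNat ((n : ℤ) + h)) : ℝ) else 0)| ≤
      (∑ i ∈ Finset.range J, ∑ a ∈ Finset.range Ks,
        ∑ j ∈ (Finset.range J).filter (fun j : ℕ => (U * 2 ^ i) * (U * 2 ^ j) ≤ N),
          |∑ d ∈ Finset.Ioc (U * 2 ^ i) (2 * (U * 2 ^ i)), ∑ m ∈ Finset.Ioc (U * 2 ^ j) (2 * (U * 2 ^ j)),
            (if d * m ≡ w [MOD q] then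
              (ArithmeticFunction.vonMangoldt d *
                  (if U * 2 ^ i + a * (U * 2 ^ i) / Ks < d ∧ d ≤ U * 2 ^ i + (a + 1) * (U * 2 ^ i) / Ks
                   then (1 : ℝ) else 0)) *
                (gU U m * (if m ≤ x / (U * 2 ^ i + (a + 1) * (U * 2 ^ i) / Ks) then (1 : ℝ) else 0)) *
                (ArithmeticFunction.liouville (Int.toNat (((d * m : ℕ) : ℤ) + h)) : ℝ)
             else 0)|) +
        Real.log N * ∑ n ∈ (Finset.Ioc (x - (N / Ks + 1)) x).filter (fun n : ℕ => n ≡ w [MOD q]),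
          ((Nat.divisors n).card : ℝ)

/-- **The crux at one shift** — verbatim the body of `LambdaLiouvilleLevel` at `h` (so that
`LambdaLiouvilleLevel ↔ ∀ h ≠ 0, LevelAt h` holds by `Iff.rfl`, `lambdaLiouvilleLevel_iff_levelAt`). -/
def LevelAt (h : ℤ) : Prop :=
  ∃ ε₀ : ℝ, 0 < ε₀ ∧ ∀ A : ℝ, 0 < A → ∃ C : ℝ, ∃ N₀ : ℕ, ∀ N : ℕ, N₀ ≤ N → ∀ w y : ℕ → ℕ,
    (∀ q, y q ≤ N) →
      (∑ q ∈ Finset.Icc 1 ⌊(N : ℝ) ^ ε₀⌋₊,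
        |∑ n ∈ (Finset.Icc 1 (y q)).filter (fun n : ℕ => n ≡ w q [MOD q]),
          ArithmeticFunction.vonMangoldt n *
            (ArithmeticFunction.liouville (Int.toNat ((n : ℤ) + h)) : ℝ)|) ≤ C * N / Real.log N ^ A

/-- The crux is the conjunction of its shifts (definitional). [folklore] -/
theorem lambdaLiouvilleLevel_iff_levelAt : LambdaLiouvilleLevel ↔ ∀ h : ℤ, h ≠ 0 → LevelAt h := Iff.rfl

/-! ## Stubs (registered; `sorry` only here) -/

/-- **Stub 1 (OPEN — conjecture-grade; the hardest stub; the lead's own).** RSA for every non-zero shift.  No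
`(log)^{−A}` rate is known for any two-point Liouville family (Matomäki–Radziwiłł–Tao / Tao give `o(1)`, log-averaged;
Helfgott–Radziwiłł, Pilatte give `(log log)`-type savings for one pair) — `Barriers.Parity.LogarithmicAveraging` bites
the target and is conceded; the bet (card): averaging over `≥ y^{1/10}/q` second dilations `m′` per row plus the `ℓ¹`
over classes and moduli is dispersion / large-values territory, not entropy decrement.  Uses `h ≠ 0`
(Disproof `lambdaLiouvilleLevel_false_without_hne`). [cite: card:log-power-dispersion; MatomakiRadziwillTao2015;
TaoFMP2016; arXiv:2103.06853; kit j015473, j016353, j016355] -/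
theorem stub_rowSumAffineChowla (h : ℤ) (hh : h ≠ 0) : RowSumAffineChowla h := by
  sorry

/-- **Stub 2 (provable now, M).** The class-aware Schur test. [cite: IwaniecKowalski2004 §7.1; card:log-power-dispersion] -/
theorem stub_classSchur : ClassSchurInequality := by
  sorry

/-- **Stub 3 (provable now, M).** Schur + RSA ⟹ log-power class type II, with `ε₂ = min(ε₁, 1/20)` and RSA at
`A′ = 2A + 2` applied to the maximising class data `(u q, v q, m₀ q)` per modulus (`Finset.exists_max_image`, as in
`TypeIIToLevel.exists_bv_max`); rows = the shorter block (the statement is symmetric under `(M,α,m) ↔ (K,β,k)` by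
`Finset.sum_comm`).  Bookkeeping in the docstring of `ClassTypeIILog`. [cite: card:log-power-dispersion (Transfer,
Cheapest falsifier (1α)); TRIAGE-r1-1; TRIAGE-r1-2] -/
theorem stub_classTypeII (h : ℤ) : ClassSchurInequality → RowSumAffineChowla h → ClassTypeIILog h := by
  sorry

/-- **Stub 4a (provable now, M; lead's reshape).** Divisor sums on a short interval in one coprime class by the
hyperbola method; bookkeeping in the docstring of `ClassDivisorShortSum`. [folklore; cite: IwaniecKowalski2004 §1.5] -/
theorem stub_classDivisorShortSum : ClassDivisorShortSum := by
  sorry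

/-- **Stub 4b (provable now, M/L; lead's reshape).** The exact per-modulus decomposition of the `F_U * G_U` piece into
`ClassTypeIILog`-shaped boxes plus one class-restricted divisor sum over the boundary strip; bookkeeping in the
docstring of `TypeIIPieceDecomp`. [folklore; cite: Vaughan1980; FriedlanderIwaniecAnnals1998 §26] -/
theorem stub_typeIIPieceDecomp : TypeIIPieceDecomp := by
  sorry

/-- **Stub 4c (provable now, M/L — the `ℓ²` bookkeeping; lead's reshape of the planner's stub 4).** With
`U = ⌊N^{1/10}⌋`, `K_s = ⌈(log N)^{A+4}⌉`, `J = Nat.log 2 N + 1` (`N < 2^J ≤ U 2^J`, `J ≤ 3 log N`), `ε₃ = ε₂`: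
apply `TypeIIPieceDecomp` at every `q ≤ N^{ε₂}` (height `x = y q ≤ N`), sum over `q`, and swap the `q`-sum inside the
`(i, a, j)`-sums; each `Σ_q |B_{i,a,j}(q)|` is ONE instance of `ClassTypeIILog h` at `y = N` (rows `d ∼ D_i = U2^i ≥ U`,
columns `m ∼ M_j = U2^j ≥ U`, `D_i M_j ≤ N`, `α q d = Λ(d) 1[E_{i,a} < d ≤ E_{i,a+1}]` with
`P_{i,a} = (E_{i,a+1} − E_{i,a}) log²(2D_i) ≤ (D_i/K_s + 1) log²(2D_i)` (`Λ ≤ log`, the step bound `hstep` of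
`TypeIIToLevel.abs_block_le`), `β q m = G_U(m) 1[m ≤ y_q/E_{i,a+1}]` with `R_j = Σ_{m ∼ M_j} τ(m)² ≤ C_τ (2M_j) log⁸(2M_j)`
(`Vaughan.abs_gU_le`, `Sieve.exists_sum_sigma_zero_pow_le_real 2`), coprime `w q`), giving
`≤ C √P_{i,a} √R_j √(D_i M_j) (log N)^{−A′} ≪ (log N)^{5−A′} D_i M_j (K_s^{−1/2} + D_i^{−1/2})`; `Σ_{j : D_i M_j ≤ N} M_j ≤ 2N/D_i`
(dyadic), `K_s` intervals, `J ≤ 3 log N` blocks: main total `≪ N (log N)^{6−A′} (√K_s + K_s/√U)`; boundary: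
`ClassDivisorShortSum` with `Z₂ = y_q`, `Z₁ = y_q − N/K_s − 1` gives `log N · Σ_{q ≤ Q} [2((N/K_s+1)/q + 1)(1 + log N) + 2√N]
≪ N log³N/K_s + Q √N log N`; with `A′ = 2A + 10` both are `≤ C N/(log N)^A` for `N ≥ N₀(A)`. Uses the height cap `y q ≤ N`
(Disproof `…_false_without_heightCap`). [cite: Vaughan1980; FriedlanderIwaniecAnnals1998 §26; IwaniecKowalski2004 §13.4;
TRIAGE-r1-1 sharpen (2),(4)] -/
theorem stub_typeIIPiece (h : ℤ) :
    ClassDivisorShortSum → TypeIIPieceDecomp → ClassTypeIILog h → TypeIIPieceLog h := by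
  sorry

/-- **Stub 5 (provable now, M — re-threading the proved `TypeIIToLevel_proof`).** The type-II piece bound ⟹ the crux
at the shift `h`, with `ε₀ = min(ε₃, 1/5)`: (i) moduli `q` with `(w q, q) > 1` are trivial — `n ≡ w q (q)` forces
`(n, q) > 1`, so `Λ(n) ≠ 0` only at powers of the primes dividing `q`, `≤ (log q/log 2 + 1)·log N` per modulus,
`≤ 2 N^{ε₀} log² N` in all; replace `w` by the coprime `w′ q := if (w q).Coprime q then w q else 1` elsewhere;
(ii) Vaughan's four terms `Λ = Λ_{≤U} + μ_{≤U} * log − c_U * ζ + F_U * G_U` (`Vaughan.vonMangoldt_eq_four_terms`,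
`U = ⌊N^{1/10}⌋`) against `lam_q(n) = 1[n ≡ w′ q (q)] λ(n+h)` inside `Σ_{n ≤ y q}`: the short piece by
`abs_sum_vonMangoldtTrunc_mul_le` (`≤ U log U` per `q`), the two type-I pieces by `abs_sum_moebiusTrunc_log_mul_le` /
`abs_sum_cU_zeta_mul_le` with the budget `F q d` of `TypeIIToLevel.typeI_budget h` (`Q·U² ≤ N^{9/20}`; Bombieri–
Vinogradov for `λ` = the proved `BVLiouville`), the fourth by the hypothesis; (iii) `Icc 1 y`-filter form ↔ `Ioc 0 y`
indicator form as in `TypeIIToLevel_proof`. [cite: Vaughan1980; IwaniecKowalski2004 §13.4;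
BombieriFriedlanderIwaniecActa1986; tree: TypeIIToLevel_proof] -/
theorem stub_vaughanAssembly (h : ℤ) : TypeIIPieceLog h → LevelAt h := by
  sorry

/-! ## Landed inputs the stubs lean on (kernel-checked, imported — no sorry) -/

/-- Type I of the line is IN TREE: the budget from Bombieri–Vinogradov for `λ` (proved), aggregated over `(q, d)`
through `lcm(d, q)` with multiplicities `τ(r)²`. -/
example (h : ℤ) {A : ℝ} (hA : 0 < A) :
    ∃ C : ℝ, ∃ X₀ : ℕ, ∀ X : ℕ, X₀ ≤ X → ∀ Q D : ℕ,
      ((Q * D : ℕ) : ℝ) ≤ (X : ℝ) ^ (1 / 2 - 1 / 20 : ℝ) →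
      ∃ F : ℕ → ℕ → ℝ, (∀ q d, 0 ≤ F q d) ∧
        (∀ q d w t : ℕ, 1 ≤ q → 1 ≤ d → ((d * t : ℕ) : ℤ) + h ≤ X →
          |∑ m ∈ Ioc 0 t, (if d * m ≡ w [MOD q] then
            (ArithmeticFunction.liouville (Int.toNat (((d * m : ℕ) : ℤ) + h)) : ℝ) else 0)| ≤ F q d) ∧
        ∑ q ∈ Icc 1 Q, ∑ d ∈ Icc 1 D, F q d ≤ C * X / Real.log X ^ A :=
  Summit.Parity.GeneralizedHardyLittlewood.Theorems.TypeIIToLevel.typeI_budget h hA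

/-- Calibration IN TREE (upstream): the route's power-saving node already gives the crux — this line replaces that
input by RSA. -/
example : TypeIILiouville → LambdaLiouvilleLevel :=
  Summit.Parity.GeneralizedHardyLittlewood.Theorems.TypeIIToLevel.TypeIIToLevel_proof

/-- Calibration IN TREE (downstream, landed Negative p96019): whatever proves the crux proves hybrid HLC(1,1) —
the line's output is of that strength, carried by RSA. -/
example (hL : LambdaLiouvilleLevel) (h : ℕ) (hh : 1 ≤ h) :
    (fun N : ℕ => Literature.NumberTheory.Sieve.hlcLiouvilleSum {0} {h} N) =o[Filter.atTop] fun N : ℕ => (N : ℝ) :=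
  Summit.Parity.GeneralizedHardyLittlewood.Theorems.LambdaLiouvilleLevel.Negative.hlc_one_one_of_lambdaLiouvilleLevel
    hL h hh

/-! ## Composition (proved, pure logic): the line closes the crux modulo its stubs -/

/-- **`LambdaLiouvilleLevel` from the seven stubs.** For a shift `h ≠ 0`: RSA (stub 1) and Schur (stub 2) give the
log-power class type II (stub 3), hence — with the class divisor bound (stub 4a) and the exact decomposition (stub 4b) —
the type-II piece of Vaughan's identity summed over the moduli (stub 4c), hence — with the tree's type-I budget and
trivial pieces — the crux at `h` (stub 5).  Concludes the route declaration BY NAME. -/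
theorem LambdaLiouvilleLevel_of : LambdaLiouvilleLevel := fun h hh =>
  stub_vaughanAssembly h
    (stub_typeIIPiece h stub_classDivisorShortSum stub_typeIIPieceDecomp
      (stub_classTypeII h stub_classSchur (stub_rowSumAffineChowla h hh)))

end Summit.Parity.GeneralizedHardyLittlewood.Cruxes.LambdaLiouvilleLevel.LogPowerDispersion

end
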